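import Summits.NavierStokesRegularity.NavierStokesRegularity.Theorems.HodographBetchovFastClassSqueezeNoConcentration
import Literature.Analysis.FluidPDE.ConstantinDirectionDissipationProofs
import Literature.Analysis.FluidPDE.TaoEnstrophyLocalisationProofs
import Literature.Analysis.FluidPDE.LerayGaugeStrainSpectrum
import Mathlib.MeasureTheory.Integral.Average
import Literature.Analysis.FluidPDE.LerayHopfH1Test

/-!
# `FastClassSqueeze` (stmt-NavierStokesRegularity-15832): the resolved / subscale (Weyl) split

Route `HodographBetchov`, crux 3; idea card `Cruxes/FastClassSqueeze/Ideas/resolved-weyl-split.md`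
(crux-ideate r1), its PROVABLE half.  Split the velocity gradient at a fixed resolution `R > 0`,
`∇u = (∇u − A_R) + A_R`, `A_R(t,x) := ⨍_{B̄_R(x)} ∇u(t,y) dy` (closed-ball average).

* `resolved_rpow_le` (B2, pointwise in time) and `resolvedFastSqueeze` (B2): the RESOLVED part is
  a-priori Miller-finite on the fast class for every `R > 0` and every `q ≥ 3`,
  `∫₀ᵀ (∫_{|u(t)|>l} ‖A_R(t,x)‖^q dx)^{2/(2q−3)} dt < ∞`, along every classical solution of unforced
  Navier–Stokes on `ℝ³ × [0,T)` that is Leray–Hopf from a rapidly decaying datum.  Proof (energy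
  class only): `‖A_R(t,x)‖ ≤ |B_R|^{-1/2} ‖∇u(t)‖_{L²}` (Cauchy–Schwarz on the ball, operator norm
  `≤` Frobenius norm), `|{|u(t)| > l}| ≤ 2E(u₀)/l²` (Chebyshev on the energy class,
  `Birth.volume_fast_le`), so the inner integral is `≤ C ‖∇u(t)‖₂^q` and its `2/(2q−3)`-th power is
  `≤ C' ‖∇u(t)‖₂^{2q/(2q−3)} ≤ C' (1 + ‖∇u(t)‖₂²)` exactly when `2q/(2q−3) ≤ 2`, i.e. `q ≥ 3`; the
  right side is integrable in time by `ν ∫₀ᵀ ‖∇u‖₂² ≤ E(u₀)`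
  (`IsLerayHopfOn.lintegral_frobeniusNormSq_fderiv_of_classical`).  At `q = 3` the energy class runs
  out: below it the same computation needs `‖∇u‖₂ ∈ L^p_t`, `p > 2`.
* (companion file `HodographBetchovFastClassSqueezeWeylSplitTransfer.lean`)
  `fastClassSqueeze_of_subscaleSqueeze` (transfer B1): the crux FOLLOWS from its SUBSCALE version —
  the same statement with `∇u` replaced by the high-pass part `∇u − A_R` in the min–max clause and
  `q ≥ 3` — because a plane on which the quadratic form of `∇u − A_R` is `≤ m` carries the form of
  `∇u` with bound `m + ‖A_R‖` (Weyl), `(m + ‖A_R‖)^q ≤ 2^{q−1}(m^q + ‖A_R‖^q)`,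
  `(X + Y)^{2/(2q−3)} ≤ X^{2/(2q−3)} + Y^{2/(2q−3)}` (`2/(2q−3) ≤ 1`), and B2.  So on the window
  `q ≥ 3` the whole open content of the crux is the subscale middle strain of the fast fluid.

Measure-theoretic bookkeeping: the resolved gradient `x ↦ A_R(t,x)` is continuous (parametric
integral over a compact ball of a jointly continuous integrand), which supplies the measurability
needed to split the inner integral; in time, the explicit majorant `K(1 + ∫ |∇u(t)|²_F)` of B2,
made measurable by a piecewise extension, is what allows the outer integral to be split.
-/

noncomputable section

-- the summit and its single problem share the name `NavierStokesRegularity` (D-0017 nested layout)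
set_option linter.dupNamespace false

namespace Summit.NavierStokesRegularity.NavierStokesRegularity.Theorems.FastClassSqueeze.WeylSplit

open Set MeasureTheory Filter Topology Metric Literature.Analysis.FluidPDE
open scoped ENNReal NNReal RealInnerProductSpace

/-! ### The resolved gradient: continuity in `x` and the Cauchy–Schwarz bound -/

/-- Translating the ball: `∫_{B̄_R(x)} h = ∫_{B̄_R(0)} h(z + x)` (translation invariance of Lebesgue
measure). [folklore] -/
theorem setIntegral_closedBall_eq_comp_add
    (h : EuclideanSpace ℝ (Fin 3) → (EuclideanSpace ℝ (Fin 3) →L[ℝ] EuclideanSpace ℝ (Fin 3)))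
    (x : EuclideanSpace ℝ (Fin 3)) (R : ℝ) :
    ∫ y in closedBall x R, h y = ∫ z in closedBall (0 : EuclideanSpace ℝ (Fin 3)) R, h (z + x) := by
  have hmp : MeasurePreserving (fun z : EuclideanSpace ℝ (Fin 3) => z + x) volume volume :=
    measurePreserving_add_right volume x
  have hpre : (fun z : EuclideanSpace ℝ (Fin 3) => z + x) ⁻¹' closedBall x R = closedBall 0 R := by
    ext z
    simp [mem_closedBall, dist_eq_norm]
  rw [← hmp.setIntegral_preimage_emb (measurableEmbedding_addRight x) h (closedBall x R), hpre]

/-- **The resolved gradient is continuous in `x`**: for a continuous `h`, `x ↦ ⨍_{B̄_R(x)} h` is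
continuous (parametric integral of the jointly continuous `(x,z) ↦ h(z + x)` over the compact
`B̄_R(0)`, times the constant `|B̄_R|⁻¹`). [folklore] -/
theorem continuous_setAverage_closedBall
    {h : EuclideanSpace ℝ (Fin 3) → (EuclideanSpace ℝ (Fin 3) →L[ℝ] EuclideanSpace ℝ (Fin 3))}
    (hh : Continuous h) (R : ℝ) :
    Continuous fun x : EuclideanSpace ℝ (Fin 3) => ⨍ y in closedBall x R, h y := by
  have heq : (fun x : EuclideanSpace ℝ (Fin 3) => ⨍ y in closedBall x R, h y) =
      fun x => (volume.real (closedBall (0 : EuclideanSpace ℝ (Fin 3)) R))⁻¹ •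
        ∫ z in closedBall (0 : EuclideanSpace ℝ (Fin 3)) R, h (z + x) := by
    funext x
    rw [setAverage_eq, setIntegral_closedBall_eq_comp_add, measureReal_def, measureReal_def,
      Measure.addHaar_closedBall_center volume x R]
  rw [heq]
  have hF : Continuous (Function.uncurry fun (x : EuclideanSpace ℝ (Fin 3))
      (z : EuclideanSpace ℝ (Fin 3)) => h (z + x)) :=
    hh.comp (continuous_snd.add continuous_fst)
  have hI : Continuous fun x : EuclideanSpace ℝ (Fin 3) =>
      ∫ z in closedBall (0 : EuclideanSpace ℝ (Fin 3)) R, h (z + x) :=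
    continuous_parametric_integral_of_continuous hF (isCompact_closedBall _ _)
  exact hI.const_smul (volume.real (closedBall (0 : EuclideanSpace ℝ (Fin 3)) R))⁻¹

/-- **Cauchy–Schwarz on the ball**: for a continuous `h` and `R > 0`,
`‖⨍_{B̄_R(x)} h‖ₑ ≤ |B̄_R|⁻¹ · |B̄_R|^{1/2} · (∫ ‖h‖²)^{1/2}` with the whole-space `L²` integral written
through any pointwise majorant `‖h(y)‖² ≤ Φ(y)` (here: operator norm `≤` Frobenius norm). [folklore] -/
theorem enorm_setAverage_closedBall_le
    {h : EuclideanSpace ℝ (Fin 3) → (EuclideanSpace ℝ (Fin 3) →L[ℝ] EuclideanSpace ℝ (Fin 3))}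
    (hh : Continuous h) {Φ : EuclideanSpace ℝ (Fin 3) → ℝ≥0∞} (hΦ : ∀ y, ‖h y‖ₑ ^ 2 ≤ Φ y)
    (x : EuclideanSpace ℝ (Fin 3)) (R : ℝ) :
    ‖⨍ y in closedBall x R, h y‖ₑ ≤
      ENNReal.ofReal (volume.real (closedBall (0 : EuclideanSpace ℝ (Fin 3)) R))⁻¹ *
        (volume (closedBall (0 : EuclideanSpace ℝ (Fin 3)) R) ^ (1 / 2 : ℝ) *
          (∫⁻ y, Φ y) ^ (1 / 2 : ℝ)) := by
  set B : Set (EuclideanSpace ℝ (Fin 3)) := closedBall x R with hB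
  have hvol : volume B = volume (closedBall (0 : EuclideanSpace ℝ (Fin 3)) R) := by
    rw [hB]; exact Measure.addHaar_closedBall_center volume x R
  -- `‖⨍ h‖ₑ = |B|⁻¹ ‖∫_B h‖ₑ ≤ |B|⁻¹ ∫_B ‖h‖ₑ`
  have h1 : ‖⨍ y in B, h y‖ₑ =
      ENNReal.ofReal (volume.real (closedBall (0 : EuclideanSpace ℝ (Fin 3)) R))⁻¹ *
        ‖∫ y in B, h y‖ₑ := by
    rw [setAverage_eq, enorm_smul, measureReal_def, hvol, ← measureReal_def,
      Real.enorm_eq_ofReal (inv_nonneg.2 measureReal_nonneg)]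
  rw [h1]
  gcongr
  -- Hölder with exponents `2, 2` on the ball
  have hmeas : AEMeasurable (fun y => ‖h y‖ₑ) (volume.restrict B) :=
    hh.enorm.measurable.aemeasurable
  have hH := ENNReal.lintegral_mul_le_Lp_mul_Lq (volume.restrict B) Real.HolderConjugate.two_two
    (f := fun _ => (1 : ℝ≥0∞)) (g := fun y => ‖h y‖ₑ) aemeasurable_const hmeas
  simp only [Pi.mul_apply, one_mul, ENNReal.one_rpow, lintegral_const, Measure.restrict_apply_univ,
    hvol] at hH
  have hsq : (∫⁻ y in B, ‖h y‖ₑ ^ (2 : ℝ)) ≤ ∫⁻ y, Φ y := by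
    calc (∫⁻ y in B, ‖h y‖ₑ ^ (2 : ℝ)) ≤ ∫⁻ y, ‖h y‖ₑ ^ (2 : ℝ) :=
          lintegral_mono' Measure.restrict_le_self le_rfl
      _ ≤ ∫⁻ y, Φ y := lintegral_mono fun y => by
          rw [ENNReal.rpow_two]
          exact hΦ y
  calc ‖∫ y in B, h y‖ₑ ≤ ∫⁻ y in B, ‖h y‖ₑ := enorm_integral_le_lintegral_enorm _
    _ ≤ volume (closedBall (0 : EuclideanSpace ℝ (Fin 3)) R) ^ (1 / (2 : ℝ)) *
          (∫⁻ y in B, ‖h y‖ₑ ^ (2 : ℝ)) ^ (1 / (2 : ℝ)) := hH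
    _ ≤ volume (closedBall (0 : EuclideanSpace ℝ (Fin 3)) R) ^ (1 / 2 : ℝ) *
          (∫⁻ y, Φ y) ^ (1 / 2 : ℝ) :=
        mul_le_mul_right (ENNReal.rpow_le_rpow hsq (by norm_num)) _


/-! ### B2: the resolved gradient is a-priori Miller-finite on the fast class (`q ≥ 3`) -/

/-- **B2, pointwise in time.** Let `(u,p)` be a classical solution of unforced Navier–Stokes on
`ℝ³ × [0,T)`, Leray–Hopf on `[0,T)` from `u 0`, `ν ≥ 0`, and let `l > 0`, `R` real, `q ≥ 3`.  There is a
finite constant `K` (depending on `R, l, q, E(u 0)` only) such that for every `t ∈ [0,T)`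
`(∫_{|u(t)|>l} ‖⨍_{B̄_R(x)} ∇u(t)‖^q dx)^{2/(2q−3)} ≤ K (1 + ∫ |∇u(t,y)|²_F dy)`:
`‖A_R‖ ≤ c (∫|∇u(t)|²_F)^{1/2}` uniformly in `x` (Cauchy–Schwarz on the ball, `‖·‖_op ≤ |·|_F`),
`|{|u(t)|>l}| ≤ 2E(u 0)/l²` (Chebyshev on the energy class), and
`(c^q V G^{q/2})^{2/(2q−3)} = K₀ G^{q/(2q−3)} ≤ K₀ (1 + G)` because `q/(2q−3) ≤ 1 ⇔ q ≥ 3`.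
[cite: Leray1934, (5.2)] -/
theorem resolved_rpow_le {ν T : ℝ} (hν : 0 ≤ ν)
    {u : ℝ → EuclideanSpace ℝ (Fin 3) → EuclideanSpace ℝ (Fin 3)}
    {p : ℝ → EuclideanSpace ℝ (Fin 3) → ℝ}
    (hcl : IsClassicalNSSolutionOn (Ico 0 T) ν 0 u p) (hLH : IsLerayHopfOn T ν 0 (u 0) u)
    {l q : ℝ} (R : ℝ) (hl : 0 < l) (hq : 3 ≤ q) :
    ∃ K : ℝ≥0∞, K ≠ ⊤ ∧ ∀ t ∈ Ico 0 T,
      (∫⁻ x in {x : EuclideanSpace ℝ (Fin 3) | l < ‖u t x‖},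
          ENNReal.ofReal ‖⨍ y in closedBall x R, fderiv ℝ (u t) y‖ ^ q) ^ (2 / (2 * q - 3)) ≤
        K * (1 + ∫⁻ y, ENNReal.ofReal (frobeniusNormSq (fderiv ℝ (u t) y))) := by
  -- ### constants
  set V : ℝ≥0∞ := volume (closedBall (0 : EuclideanSpace ℝ (Fin 3)) R) with hV
  have hVtop : V ≠ ⊤ := measure_closedBall_lt_top.ne
  set c : ℝ≥0∞ := ENNReal.ofReal (volume.real (closedBall (0 : EuclideanSpace ℝ (Fin 3)) R))⁻¹ *
    V ^ (1 / 2 : ℝ) with hc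
  have hctop : c ≠ ⊤ :=
    ENNReal.mul_ne_top ENNReal.ofReal_ne_top (ENNReal.rpow_ne_top_of_nonneg (by norm_num) hVtop)
  set Vl : ℝ≥0∞ := ENNReal.ofReal (2 * VectorCalculus.kineticEnergy (u 0) / l ^ 2) with hVl
  set r : ℝ := 2 / (2 * q - 3) with hr
  have hq0 : 0 ≤ q := by linarith
  have h2q3 : 0 < 2 * q - 3 := by linarith
  have hr0 : 0 ≤ r := by rw [hr]; exact div_nonneg zero_le_two h2q3.le
  have hs0 : 0 ≤ q / 2 * r := mul_nonneg (by positivity) hr0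
  have hs1 : q / 2 * r ≤ 1 := by
    rw [hr, div_mul_div_comm, div_le_one (mul_pos two_pos h2q3)]
    nlinarith
  set K : ℝ≥0∞ := (c ^ q * Vl) ^ r with hK
  have hKtop : K ≠ ⊤ := by
    rw [hK]
    refine ENNReal.rpow_ne_top_of_nonneg hr0 (ENNReal.mul_ne_top ?_ ENNReal.ofReal_ne_top)
    exact ENNReal.rpow_ne_top_of_nonneg hq0 hctop
  refine ⟨K, hKtop, fun t ht => ?_⟩
  -- ### the slice
  set D : EuclideanSpace ℝ (Fin 3) → (EuclideanSpace ℝ (Fin 3) →L[ℝ] EuclideanSpace ℝ (Fin 3)) :=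
    fun y => fderiv ℝ (u t) y with hD
  set G : ℝ≥0∞ := ∫⁻ y, ENNReal.ofReal (frobeniusNormSq (D y)) with hG
  have hsmooth : ContDiff ℝ 1 (u t) := (hcl.contDiff_velocity ht).of_le (by norm_cast)
  have hDcont : Continuous D := by rw [hD]; exact hsmooth.continuous_fderiv one_ne_zero
  have hΦ : ∀ y, ‖D y‖ₑ ^ 2 ≤ ENNReal.ofReal (frobeniusNormSq (D y)) := by
    intro y
    rw [← ofReal_norm, ← ENNReal.ofReal_pow (norm_nonneg _)]
    exact ENNReal.ofReal_le_ofReal (sq_opNorm_le_frobeniusNormSq _)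
  -- ### (a) uniform bound on the resolved gradient
  have hA : ∀ x, ENNReal.ofReal ‖⨍ y in closedBall x R, D y‖ ≤ c * G ^ (1 / 2 : ℝ) := by
    intro x
    rw [ofReal_norm, hc, mul_assoc]
    exact enorm_setAverage_closedBall_le hDcont hΦ x R
  -- ### (b) the inner integral over the fast class
  set F : Set (EuclideanSpace ℝ (Fin 3)) := {x | l < ‖u t x‖} with hF
  have hvolF : volume F ≤ Vl :=
    Birth.volume_fast_le hν hLH ⟨ht.1, ht.2.le⟩
      (hcl.contDiff_velocity ht).continuous.measurable.aemeasurable hl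
  have hinner : (∫⁻ x in F, ENNReal.ofReal ‖⨍ y in closedBall x R, D y‖ ^ q) ≤
      (c * G ^ (1 / 2 : ℝ)) ^ q * Vl := by
    calc (∫⁻ x in F, ENNReal.ofReal ‖⨍ y in closedBall x R, D y‖ ^ q)
        ≤ ∫⁻ _ in F, (c * G ^ (1 / 2 : ℝ)) ^ q :=
          lintegral_mono fun x => ENNReal.rpow_le_rpow (hA x) hq0
      _ = (c * G ^ (1 / 2 : ℝ)) ^ q * volume F := setLIntegral_const _ _
      _ ≤ (c * G ^ (1 / 2 : ℝ)) ^ q * Vl := by gcongr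
  -- ### (c) exponent bookkeeping: `((c G^{1/2})^q Vl)^r = K G^{q r / 2} ≤ K (1 + G)`
  have halg : ((c * G ^ (1 / 2 : ℝ)) ^ q * Vl) ^ r = K * G ^ (q / 2 * r) := by
    have h1 : (c * G ^ (1 / 2 : ℝ)) ^ q = c ^ q * G ^ (q / 2) := by
      rw [ENNReal.mul_rpow_of_nonneg _ _ hq0, ← ENNReal.rpow_mul, one_div_mul_eq_div]
    have h2 : (G ^ (q / 2)) ^ r = G ^ (q / 2 * r) := (ENNReal.rpow_mul _ _ _).symm
    have h3 : c ^ q * G ^ (q / 2) * Vl = (c ^ q * Vl) * G ^ (q / 2) := by ring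
    rw [hK, h1, h3, ENNReal.mul_rpow_of_nonneg _ _ hr0, h2]
  calc (∫⁻ x in F, ENNReal.ofReal ‖⨍ y in closedBall x R, D y‖ ^ q) ^ r
      ≤ ((c * G ^ (1 / 2 : ℝ)) ^ q * Vl) ^ r := ENNReal.rpow_le_rpow hinner hr0
    _ = K * G ^ (q / 2 * r) := halg
    _ ≤ K * (1 + G) := mul_le_mul_right (ENNReal.rpow_le_one_add_self G hs0 hs1) _

/-- **B2 — the resolved fast squeeze holds a priori** (idea `resolved-weyl-split`, Sketch B2).
Along every classical solution of unforced Navier–Stokes on `ℝ³ × [0,T)` that is Leray–Hopf from a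
rapidly decaying datum, for every speed level `l > 0`, resolution `R > 0` and exponent `q ≥ 3`, the
ball-averaged gradient `A_R(t,x) = ⨍_{B̄_R(x)} ∇u(t)` lies in the Miller–Serrin class on the fast
class: `∫₀ᵀ (∫_{|u(t)|>l} ‖A_R(t,x)‖^q dx)^{2/(2q−3)} dt < ∞`.  By `resolved_rpow_le` the integrand is
`≤ K(1 + ∫|∇u(t)|²_F)`, and `∫₀ᵀ∫|∇u|²_F < ∞` for a classical Leray–Hopf solution
(`IsLerayHopfOn.lintegral_frobeniusNormSq_fderiv_of_classical`, Constantin 1990 (2.21)).  The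
energy class is used exactly twice (`|{|u|>l}| ≤ 2E₀/l²`, `ν∫∫|∇u|² ≤ E₀`) and `q = 3` is where it
runs out (`2q/(2q−3) ≤ 2 ⇔ q ≥ 3`). [cite: Constantin1990, §2 eq. (2.21)] -/
theorem resolvedFastSqueeze :
    ∀ (ν T : ℝ), 0 < ν → 0 < T →
      ∀ (u : ℝ → EuclideanSpace ℝ (Fin 3) → EuclideanSpace ℝ (Fin 3))
        (p : ℝ → EuclideanSpace ℝ (Fin 3) → ℝ),
        Literature.Analysis.FluidPDE.IsClassicalNSSolutionOn (Set.Ico 0 T) ν 0 u p →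
        Literature.Analysis.FluidPDE.IsLerayHopfOn T ν 0 (u 0) u →
        Literature.Analysis.FluidPDE.HasRapidSpatialDecay (u 0) →
        ∀ l R q : ℝ, 0 < l → 0 < R → 3 ≤ q →
          ∫⁻ t in Set.Ioo 0 T, (∫⁻ x in {x : EuclideanSpace ℝ (Fin 3) | l < ‖u t x‖},
            ENNReal.ofReal ‖⨍ y in Metric.closedBall x R, fderiv ℝ (u t) y‖ ^ q) ^
              (2 / (2 * q - 3)) < ⊤ := by
  intro ν T hν hT u p hcl hLH _hdec l R q hl _hR hq
  obtain ⟨K, hKtop, hK⟩ := resolved_rpow_le hν.le hcl hLH R hl hq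
  obtain ⟨hGfin, -⟩ := hLH.lintegral_frobeniusNormSq_fderiv_of_classical hcl hT
  have hle : ∫⁻ t in Ioo 0 T, (∫⁻ x in {x : EuclideanSpace ℝ (Fin 3) | l < ‖u t x‖},
        ENNReal.ofReal ‖⨍ y in closedBall x R, fderiv ℝ (u t) y‖ ^ q) ^ (2 / (2 * q - 3)) ≤
      ∫⁻ t in Ioo 0 T, K * (1 + ∫⁻ y, ENNReal.ofReal (frobeniusNormSq (fderiv ℝ (u t) y))) := by
    refine lintegral_mono_ae ?_
    filter_upwards [ae_restrict_mem measurableSet_Ioo] with t ht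
    exact hK t (Ioo_subset_Ico_self ht)
  refine lt_of_le_of_lt hle ?_
  rw [lintegral_const_mul' _ _ hKtop, lintegral_add_left measurable_const, lintegral_const,
    Measure.restrict_apply_univ, Real.volume_Ioo]
  refine ENNReal.mul_lt_top hKtop.lt_top ?_
  exact ENNReal.add_lt_top.2 ⟨by rw [one_mul]; exact ENNReal.ofReal_lt_top, hGfin.lt_top⟩

end Summit.NavierStokesRegularity.NavierStokesRegularity.Theorems.FastClassSqueeze.WeylSplit

end
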